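import Literature.NumberTheory.DiophantineGeometry.SchurWeylHighestWeightProofs
import Literature.NumberTheory.DiophantineGeometry.SchurWeylPlethysmIrreducibleProofs
import Mathlib.LinearAlgebra.Matrix.SpecialLinearGroup
import Mathlib.Analysis.Complex.Polynomial.Basic
import HarnessLib

/-!
# Ikenmeyer–Kandasamy 2020, Thm. 9.1 for Thm. 4.2 — brick M2: the row-word coefficient separates the Weyl module along `SL_m`

Topic `Literature/Computability/AlgebraicComplexity` (val-lit cell, programme "IK20 #3" = discharge
of the cite-fact `IK2020_thm_9_1_orbitFunctions`, route `HOME/bip/NOTE-t02g6-G-discharge-sizing.md`,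
brick M2). Theorems only: no definition, no named fact, no instance.

The orbit functions of IK 2020 §9 (TeX L733–800: "`HWV_{λ*}(ℂ[G]^H)` is spanned by functions
`g ↦ γ(gv)`, `v ∈ {λ}^H`") are, in the tree's model `{λ} = c_λ · (ℂ^m)^{⊗n}` (`weylModule`), the
matrix coefficients `g ↦ (g · h)_{w₀}` — the `e_{w₀}`-coordinate (`tensorBasis … repr … (rowWord λ)`)
of the translate `g · h`, `w₀` the row word of the canonical tableau. This file proves that these
coefficients SEPARATE `{λ}` already along `SL_m(ℂ)`:

* `IK2020.repr_glTensorRep_eq_pow_mul_of_coe_eq_smul` — a matrix `g = t · s` acts on `n`-tensors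
  as `t^n · s` (coordinates);
* `IK2020.exists_coe_eq_smul_specialLinear` — over `ℂ` every `g ∈ GL_m` is `t · s`, `s ∈ SL_m`
  (`t^m = det g`);
* `IK2020.eq_zero_of_forall_sl_repr_rowWord_eq_zero` — if `h ∈ {λ}` and `(s · h)_{w₀} = 0` for all
  `s ∈ SL_m(ℂ)`, then `h = 0`: the vanishing set is an `SL_m`-stable, hence (homogeneity) `GL_m`-stable
  subspace of the irreducible `{λ}` (`isIrreducible_weylRep_holds`, Fulton–Harris Thm. 6.3) not
  containing the highest-weight vector `c_λ e_{w₀}` (`repr_hwVector_rowWord`: coefficient `|R_λ| ≠ 0`).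

This is the injectivity half of IK's "`HWV_{λ*}(ℂ[G]^{H}) ≃ {λ}^H`" (§9, TeX L792–798), obtained
without Peter–Weyl. Honest framing: bookkeeping of IK's toy model; VP ≠ VNP is NOT proved.

## References
* [IkenmeyerKandasamy2019] C. Ikenmeyer, U. Kandasamy, arXiv:1911.03990, §9 (Thm. 9.1 and the
  paragraph "H-invariants", TeX L733–800).
* [FultonHarrisGTM129] W. Fulton, J. Harris, *Representation Theory*, Thm. 6.3, §15.5.
-/

noncomputable section

open scoped BigOperators

namespace Literature.Computability.AlgebraicComplexity

open _root_.Literature.NumberTheory.DiophantineGeometry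

namespace IK2020

variable {k : Type*} [Field k] {N n : ℕ}

/-- A matrix `g` with `g = t · s` acts on `n`-fold tensors as `t^n` times `s` (in coordinates:
`(g · v)_J = ∑_I (∏_j g_{J j, I j}) v_I`, `repr_glTensorRep`). (IK §13, TeX L1153–1154: "Since all
these functions are homogeneous of the same degree … linearly independent … on `SL_m p`".)
[cite: IkenmeyerKandasamy2019, §13 (proof of Thm. 4.2), TeX L1153–1154] -/
theorem repr_glTensorRep_eq_pow_mul_of_coe_eq_smul (g g' : GL (Fin N) k) (t : k)
    (hg : (g : Matrix (Fin N) (Fin N) k) = t • (g' : Matrix (Fin N) (Fin N) k))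
    (v : TensorPower k n (Fin N → k)) (J : Fin n → Fin N) :
    (tensorBasis k (Fin N) n).repr (glTensorRep (Fin N) k n g v) J =
      t ^ n * (tensorBasis k (Fin N) n).repr (glTensorRep (Fin N) k n g' v) J := by
  rw [repr_glTensorRep, repr_glTensorRep, Finset.mul_sum]
  refine Finset.sum_congr rfl fun I _ => ?_
  rw [hg, ← mul_assoc]
  congr 1
  simp only [Matrix.smul_apply, smul_eq_mul, Finset.prod_mul_distrib, Finset.prod_const,
    Finset.card_univ, Fintype.card_fin]

/-- Over `ℂ`, every invertible `m × m` matrix (`m ≥ 1`) is `t · s` with `t^m = det g` and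
`s ∈ SL_m(ℂ)`. (IK §13, TeX L1153–1154: passage from `GL_m p` to `SL_m p`.)
[cite: IkenmeyerKandasamy2019, §13 (proof of Thm. 4.2), TeX L1153–1154] -/
theorem exists_coe_eq_smul_specialLinear {m : ℕ} (hm : 0 < m) (g : GL (Fin m) ℂ) :
    ∃ (t : ℂ) (s : Matrix.SpecialLinearGroup (Fin m) ℂ), t ≠ 0 ∧
      (g : Matrix (Fin m) (Fin m) ℂ) = t • (s : Matrix (Fin m) (Fin m) ℂ) := by
  have hdet : (g : Matrix (Fin m) (Fin m) ℂ).det ≠ 0 := by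
    rw [← Matrix.GeneralLinearGroup.val_det_apply]
    exact Units.ne_zero _
  obtain ⟨t, ht⟩ := IsAlgClosed.exists_pow_nat_eq (g : Matrix (Fin m) (Fin m) ℂ).det hm
  have ht0 : t ≠ 0 := by
    rintro rfl
    rw [zero_pow hm.ne'] at ht
    exact hdet ht.symm
  refine ⟨t, ⟨t⁻¹ • (g : Matrix (Fin m) (Fin m) ℂ), ?_⟩, ht0, ?_⟩
  · rw [Matrix.det_smul, Fintype.card_fin, inv_pow, ht, inv_mul_cancel₀ hdet]
  · change (g : Matrix (Fin m) (Fin m) ℂ) = t • (t⁻¹ • (g : Matrix (Fin m) (Fin m) ℂ))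
    rw [smul_inv_smul₀ ht0]

/-- **M2 — the row-word coefficient separates `{λ}` along `SL_m(ℂ)`** (IK 2020 §9, TeX L792–798,
injectivity of `v ↦ (g ↦ γ(g v))` on `{λ}`, here for the model `{λ} = c_λ · (ℂ^m)^{⊗n}` and the
functional `e_{w₀}^*`, `w₀` the row word): if `h ∈ {λ}` and the `e_{w₀}`-coordinate of `s · h`
vanishes for every `s ∈ SL_m(ℂ)`, then `h = 0`. Proof: the coordinates of `g · h` for `g ∈ GL_m`
vanish too (`g = t·s`, homogeneity); the vanishing locus is a subrepresentation of the irreducible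
`weylRep` (`isIrreducible_weylRep_holds`), and it misses the highest-weight vector `c_λ e_{w₀}`
whose `e_{w₀}`-coordinate is `|R_λ| ≠ 0` (`repr_hwVector_rowWord`), so it is `⊥`.
[cite: IkenmeyerKandasamy2019, §9 (Thm. 9.1, "H-invariants"), TeX L792–798] -/
theorem eq_zero_of_forall_sl_repr_rowWord_eq_zero {m n : ℕ} (hm : 0 < m) (lam : Nat.Partition n)
    (hlam : lam.parts.card ≤ m) {h : TensorPower ℂ n (Fin m → ℂ)}
    (hh : h ∈ weylModule ℂ (Fin m) lam)
    (h0 : ∀ s : Matrix.SpecialLinearGroup (Fin m) ℂ,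
      (tensorBasis ℂ (Fin m) n).repr
        (glTensorRep (Fin m) ℂ n (Matrix.SpecialLinearGroup.toGL s) h) (rowWord lam hlam) = 0) :
    h = 0 := by
  classical
  -- all `GL_m`-translates have vanishing `e_{w₀}`-coordinate
  have hGL : ∀ (g : GL (Fin m) ℂ) (v : TensorPower ℂ n (Fin m → ℂ)),
      (∀ s : Matrix.SpecialLinearGroup (Fin m) ℂ,
        (tensorBasis ℂ (Fin m) n).repr
          (glTensorRep (Fin m) ℂ n (Matrix.SpecialLinearGroup.toGL s) v) (rowWord lam hlam) = 0) →
      (tensorBasis ℂ (Fin m) n).repr (glTensorRep (Fin m) ℂ n g v) (rowWord lam hlam) = 0 := by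
    intro g v hv
    obtain ⟨t, s, -, hgs⟩ := exists_coe_eq_smul_specialLinear hm g
    rw [repr_glTensorRep_eq_pow_mul_of_coe_eq_smul g (Matrix.SpecialLinearGroup.toGL s) t
      (by rw [hgs]; rfl) v, hv s, mul_zero]
  -- the vanishing locus as a subrepresentation of the Weyl module
  let K : Subrepresentation (weylRep ℂ (Fin m) lam) :=
    { toSubmodule :=
        { carrier := {v | ∀ g : GL (Fin m) ℂ,
            (tensorBasis ℂ (Fin m) n).repr (glTensorRep (Fin m) ℂ n g (v : TensorPower ℂ n (Fin m → ℂ)))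
              (rowWord lam hlam) = 0}
          add_mem' := fun {a b} ha hb g => by
            simp only [Set.mem_setOf_eq] at ha hb ⊢
            rw [Submodule.coe_add, map_add, map_add, Finsupp.add_apply, ha g, hb g, add_zero]
          zero_mem' := fun g => by simp
          smul_mem' := fun c v hv g => by
            simp only [Set.mem_setOf_eq] at hv ⊢
            rw [Submodule.coe_smul, map_smul, map_smul, Finsupp.smul_apply, hv g, smul_zero] }
      apply_mem_toSubmodule := fun g' v hv g => by
        rw [coe_weylRep_apply, ← Module.End.mul_apply, ← map_mul]
        exact hv (g * g') }
  haveI : Representation.IsIrreducible (V := weylModule ℂ (Fin m) lam) (weylRep ℂ (Fin m) lam) :=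
    isIrreducible_weylRep_holds ℂ (Fin m) lam (by rwa [Fintype.card_fin])
  rcases IsSimpleOrder.eq_bot_or_eq_top K with hK | hK
  · -- `K = ⊥`: our `h` lies in `K`
    have hmem : (⟨h, hh⟩ : weylModule ℂ (Fin m) lam) ∈ K.toSubmodule := fun g => hGL g h h0
    rw [hK] at hmem
    change (⟨h, hh⟩ : weylModule ℂ (Fin m) lam) ∈ (⊥ : Submodule ℂ (weylModule ℂ (Fin m) lam)) at hmem
    rw [Submodule.mem_bot] at hmem
    exact congrArg Subtype.val hmem
  · -- `K = ⊤` is absurd: the highest-weight vector has `e_{w₀}`-coordinate `|R_λ| ≠ 0`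
    exfalso
    have hmem : (⟨hwVector ℂ lam hlam, hwVector_mem_weylModule lam hlam⟩ :
        weylModule ℂ (Fin m) lam) ∈ K.toSubmodule := by
      rw [hK]
      change _ ∈ (⊤ : Submodule ℂ (weylModule ℂ (Fin m) lam))
      exact Submodule.mem_top
    have h1 := hmem 1
    simp only [map_one, Module.End.one_apply] at h1
    rw [repr_hwVector_rowWord] at h1
    exact Nat.cast_ne_zero.mpr Fintype.card_ne_zero h1

end IK2020

end Literature.Computability.AlgebraicComplexity

end
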